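import Summits.KontsevichZagierPeriods.KontsevichZagierPeriods.Theses.HodgeColevel
import Summits.KontsevichZagierPeriods.KontsevichZagierPeriods.Theorems.LowDimensionLowdimDimZero
import Literature.NumberTheory.Transcendental.KZDegree

/-!
# `SameDegreeConjecture` (stmt-KontsevichZagierPeriods-6178, route HodgeColevel, rank 5) — birth skeleton

Crux (OPEN CORE 2, the same-degree half of Kontsevich–Zagier's Conjecture 1): two integral
representations of one dimension `d`, both INCOMPRESSIBLE (not KZ-equivalent to any representation
of dimension `< d`, i.e. `KZ.IsIncompressible`, `KZ.degree r = d`), with the same value, are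
`KZ.Equivalent`.

Line `birth` = the route's own foreseen split of this crux ("SameDegreeConjecture ⇐ SameDegreeOne →
SameDegreeTwoUp → SameDegreeConjecture, split by the degree `d`", route header § TWO-LAYER PLAN),
sharpened by one normalisation that keeps the degree: the strata of the KZ-degree are cut as

* `d = 0` — PROVED in the tree and used in the glue: two `0`-dimensional representations with equal
  values are equivalent (`LowDimension.LowdimDimZero`, item stmt-KontsevichZagierPeriods-0119,
  `lowdimDimZero_proof`; no transcendence input);
* `stub_sameDegreeOne` — the rung `d = 1`, VERBATIM the route's support item `SameDegreeOne`
  (stmt-KontsevichZagierPeriods-6182): two `1`-dimensional representations, neither equivalent to a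
  constant, with the same value are equivalent (values of `1`-dimensional semialgebraic
  representations are 1-periods; Huber–Wüstholz 2022 Thm 13.3 — all linear relations among 1-periods
  come from bilinearity and functoriality of curve pairs — plus the dimension-1 transfer of
  functoriality along finite maps of curves into moves);
* `stub_openCubeNormalForm` — DIMENSION-PRESERVING OPEN-CUBE NORMAL FORM (a theorem of real
  algebraic geometry inside the rules, the bookkeeping every stratum-wise statement needs): every
  `d`-dimensional representation is KZ-equivalent to a `d`-dimensional representation over the open
  unit cube `(0,1)ᵈ` — `ℚ`-semialgebraic `C¹` cell decomposition of the domain (van den Dries Ch. 7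
  (3.2); tree: `Literature.ModelTheory.ExponentialFields.exists_c1CAD`, `IsC1SACell.exists_c1_chart`),
  cells of dimension `< d` are Lebesgue-null hence relations (rule (1a) with `σ = σ ∪ σ`), each open
  cell is the image of `(0,1)ᵈ` under an injective `C¹` `ℚ`-semialgebraic chart (rule (2), Jacobian
  factor `|det Φ'|`, integrability by the change-of-variables theorem), and the finitely many cube
  representations so obtained merge into one by additivity of the integrand (rule (1b)). It never
  changes the dimension, so it respects the degree (`KZ.degree_eq_of_equivalent`);
* `stub_sameDegreeCubeTwoUp` — the rungs `d ≥ 2` in normal form: two incompressible representations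
  OVER THE SAME OPEN CUBE `(0,1)ᵈ`, `d ≥ 2`, with equal values are equivalent. On a common domain the
  difference of the integrands has integral `0`, so this is the kernel form of Conjecture 1 on the
  top stratum of each dimension (`d = 2`: Euler `ζ(2) = π²/6`, Catalan-type and elliptic area
  identities; `d = w`: the weight-`w` MZV relations with regularised intermediates). This stub carries
  the crux's own risk (why it might fail: a non-equivalent incompressible pair of equal value refutes
  it and the summit together).

Composition (sorry-free): `sameDegreeConjecture_of_stubs : <stub₁-sig> → <stub₂-sig> → <stub₃-sig> →
<crux, unfolded verbatim>` by cases on `d`: `0` ↦ `lowdimDimZero_proof`; `1` ↦ `stub_sameDegreeOne`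
(the hypothesis `∀ k < 1, …` specialised to `k = 0`); `n + 2` ↦ move both representations to the open
cube (`stub_openCubeNormalForm`), transport incompressibility (transitivity of `KZ.Equivalent`) and the
value (soundness `KZ.Equivalent.value_eq_holds`) to the cube representatives, apply
`stub_sameDegreeCubeTwoUp`, and chain back `r ∼ c ∼ c' ∼ r'`. `SameDegreeConjecture_of :
SameDegreeConjecture` feeds the three stubs in BY NAME (the theorem the skeleton audit keys on; the
audit admits no inline `Prop` hypotheses, hence the two-theorem shape, as in
`Cruxes/BetaProductSector/Lines/birth.lean`).

Disproof used: none on file (no `Disproof.lean` for this crux, no dead lines; `ledger negatives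
--problem KontsevichZagierPeriods` has no same-degree / normal-form statement).
[cite: KontsevichZagierPeriods2001, §1.2 Conjecture 1, Problem 2] [cite: HuberWustholz2022, Thm 13.3]
[cite: Dries1998, Ch. 7 (3.2)] [cite: BochnakCosteRoy1998, Prop. 2.9.10, §9.1]
-/

set_option linter.dupNamespace false

noncomputable section

namespace Summit.KontsevichZagierPeriods.KontsevichZagierPeriods.Cruxes.SameDegreeConjecture.Birth

open Summit.KontsevichZagierPeriods.KontsevichZagierPeriods.Theses.HodgeColevel (SameDegreeConjecture)

/-! ## The three stubs -/

/-- Stub 1 — THE RUNG `d = 1` (verbatim the route's support item `SameDegreeOne`,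
stmt-KontsevichZagierPeriods-6182): two `1`-dimensional integral representations, neither
KZ-equivalent to a constant, with the same value are KZ-equivalent. Values of `1`-dimensional
`ℚ`-semialgebraic representations are cohomological 1-periods (curves relative to points);
Huber–Wüstholz's theorem (all `ℚ̄`-linear relations among 1-periods are induced by bilinearity and
functoriality of curve pairs) plus the dimension-`1` transfer of functoriality along finite maps of
curves into moves (monotone branches = changes of variables, several sheets = sheet transfer).
Why it might fail: a Huber–Wüstholz relation forced through a correspondence / Cauchy residue with
no chain of REAL semialgebraic moves in dimension `≤ 2` (route HermiteRigidity's genus-2 identity).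
Size XL (open in the tree; the Huber–Wüstholz sector). Sources: HuberWustholz2022 Thm 13.3 / 9.10,
KontsevichZagierPeriods2001 §1.2, Baker1975. [cite: HuberWustholz2022, Thm 13.3] -/
theorem stub_sameDegreeOne : ∀ (r r' : Literature.NumberTheory.Transcendental.KZ.IntegralRep 1), (∀ s : Literature.NumberTheory.Transcendental.KZ.IntegralRep 0, ¬ Literature.NumberTheory.Transcendental.KZ.Equivalent r s) → (∀ s : Literature.NumberTheory.Transcendental.KZ.IntegralRep 0, ¬ Literature.NumberTheory.Transcendental.KZ.Equivalent r' s) → r.value = r'.value → Literature.NumberTheory.Transcendental.KZ.Equivalent r r' := by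
  sorry

/-- Stub 2 — DIMENSION-PRESERVING OPEN-CUBE NORMAL FORM (real algebraic geometry inside the rules):
every `d`-dimensional integral representation is KZ-equivalent to a `d`-dimensional representation
whose domain is the open unit cube `(0,1)ᵈ`. Route to a proof: `ℚ`-semialgebraic `C¹` cell
decomposition of `r.domain` (tree: `Literature.ModelTheory.ExponentialFields.exists_c1CAD`,
`IsC1SACell.exists_c1_chart`; van den Dries Ch. 7 (3.2), Bochnak–Coste–Roy Prop. 2.9.10 / §9.1);
split the domain along the cells by rule (1a) (`IntegralRep.restrict`, pairwise disjoint cells);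
cells of dimension `< d` are Lebesgue-null, hence their representations are relations (rule (1a)
for `σ = σ ∪ σ`, as in `IntegralRep.of_empty_mem_relations`); each open cell `C` is `Φ '' (0,1)ᵈ`
for an injective `C¹` `ℚ`-semialgebraic chart `Φ` (band-by-band affine reparametrisation, unbounded
ends by `u ↦ u/(1-u)`), so `[(0,1)ᵈ, (f ∘ Φ)·|det Φ'|] − [C, f] ∈ KZ.changeOfVariablesRel`
(integrability by `MeasureTheory.integrableOn_image_iff_integrableOn_abs_det_fderiv_smul`,
semialgebraicity of the Jacobian by definability of derivatives); finally the cube representations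
merge into one by rule (1b) (common domain). For `d = 0` the cube is the point and an empty-domain
representation is a relation, equivalent to the zero representation on the point. Dimension is
never changed, so the KZ-degree is respected (`KZ.degree_eq_of_equivalent`).
Why it might fail: only Lean-side — the `C¹` cell decomposition in the tree is over `ℝ`-coefficients
(`IsSemialgebraic ℝ`) and the calculus wants `ℚ`-semialgebraic cells and charts (definability over
`ℚ`, Tarski–Seidenberg with `ℚ`-parameters), plus the cube charts of open cells and the Jacobian
bookkeeping. Size L–XL. Sources: Dries1998 Ch. 7 (3.2), BochnakCosteRoy1998 Prop. 2.9.10 and §9.1,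
KontsevichZagierPeriods2001 §1.2 rules (1), (2). [cite: Dries1998, Ch. 7 (3.2)] -/
theorem stub_openCubeNormalForm : ∀ (d : ℕ) (r : Literature.NumberTheory.Transcendental.KZ.IntegralRep d), ∃ c : Literature.NumberTheory.Transcendental.KZ.IntegralRep d, c.domain = {z | ∀ i, z i ∈ Set.Ioo (0:ℝ) 1} ∧ Literature.NumberTheory.Transcendental.KZ.Equivalent r c := by
  sorry

/-- Stub 3 — THE RUNGS `d ≥ 2` IN NORMAL FORM (the bet; carries the crux's own risk): two
INCOMPRESSIBLE `d`-dimensional representations over the SAME open unit cube `(0,1)ᵈ`, `d ≥ 2`, with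
equal values are KZ-equivalent. On a common domain the two integrands differ by a `ℚ`-semialgebraic
integrable function of integral `0`, so this is the kernel form of Conjecture 1 on the top stratum
`degree = dimension = d` of each dimension: `d = 2` holds Euler's `ζ(2) = π²/6`, the Catalan-type and
elliptic area identities (route HodgeLevel's layer), `d = w` the weight-`w` MZV relations; the
incompressibility hypotheses of concrete pairs are certified by the route's engine (`PiPowDegree`,
`MZVWeightDegree`, `EllipticSquareDegree`). Why it might fail: summit-strength on its stratum — at
`d = w` it contains all weight-`w` MZV identities with regularised intermediates and the Γ-detour
identities (route Neg pressure points (a), (b)); a non-equivalent incompressible pair of equal value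
refutes it and the summit together. Size: open problem. Sources: KontsevichZagierPeriods2001 §1.2
Conjecture 1 / Problem 2, HuberMullerStachPeriods2017 Ch. 13, CressonViusos2022 §1, Brown2012.
[cite: KontsevichZagierPeriods2001, §1.2 Conjecture 1] -/
theorem stub_sameDegreeCubeTwoUp : ∀ (d : ℕ), 2 ≤ d → ∀ (c c' : Literature.NumberTheory.Transcendental.KZ.IntegralRep d), c.domain = {z | ∀ i, z i ∈ Set.Ioo (0:ℝ) 1} → c'.domain = {z | ∀ i, z i ∈ Set.Ioo (0:ℝ) 1} → (∀ k < d, ∀ s : Literature.NumberTheory.Transcendental.KZ.IntegralRep k, ¬ Literature.NumberTheory.Transcendental.KZ.Equivalent c s) → (∀ k < d, ∀ s : Literature.NumberTheory.Transcendental.KZ.IntegralRep k, ¬ Literature.NumberTheory.Transcendental.KZ.Equivalent c' s) → c.value = c'.value → Literature.NumberTheory.Transcendental.KZ.Equivalent c c' := by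
  sorry

/-! ## Glue (sorry-free) -/

open Literature.NumberTheory.Transcendental

/-- The composition, arrow form: RUNG ONE → OPEN-CUBE NORMAL FORM → CUBE RUNGS `d ≥ 2` → the crux
(UNFOLDED verbatim, so that exactly one theorem of this file, `SameDegreeConjecture_of`, concludes the
crux by name). Cases on the degree `d`: `0` is LowDimension's proved item `LowdimDimZero`; `1` is the
first stub with `∀ k < 1` specialised to `k = 0`; for `n + 2` both representations are moved to the
open cube WITHOUT CHANGING THE DIMENSION, incompressibility and the value travel along the
equivalences (transitivity; soundness `KZ.Equivalent.value_eq_holds`), the third stub identifies the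
two cube representatives, and the chain `r ∼ c ∼ c' ∼ r'` closes.
[cite: KontsevichZagierPeriods2001, §1.2 Conjecture 1, Problem 2] -/
theorem sameDegreeConjecture_of_stubs
    (h1 : ∀ (r r' : Literature.NumberTheory.Transcendental.KZ.IntegralRep 1), (∀ s : Literature.NumberTheory.Transcendental.KZ.IntegralRep 0, ¬ Literature.NumberTheory.Transcendental.KZ.Equivalent r s) → (∀ s : Literature.NumberTheory.Transcendental.KZ.IntegralRep 0, ¬ Literature.NumberTheory.Transcendental.KZ.Equivalent r' s) → r.value = r'.value → Literature.NumberTheory.Transcendental.KZ.Equivalent r r')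
    (h2 : ∀ (d : ℕ) (r : Literature.NumberTheory.Transcendental.KZ.IntegralRep d), ∃ c : Literature.NumberTheory.Transcendental.KZ.IntegralRep d, c.domain = {z | ∀ i, z i ∈ Set.Ioo (0:ℝ) 1} ∧ Literature.NumberTheory.Transcendental.KZ.Equivalent r c)
    (h3 : ∀ (d : ℕ), 2 ≤ d → ∀ (c c' : Literature.NumberTheory.Transcendental.KZ.IntegralRep d), c.domain = {z | ∀ i, z i ∈ Set.Ioo (0:ℝ) 1} → c'.domain = {z | ∀ i, z i ∈ Set.Ioo (0:ℝ) 1} → (∀ k < d, ∀ s : Literature.NumberTheory.Transcendental.KZ.IntegralRep k, ¬ Literature.NumberTheory.Transcendental.KZ.Equivalent c s) → (∀ k < d, ∀ s : Literature.NumberTheory.Transcendental.KZ.IntegralRep k, ¬ Literature.NumberTheory.Transcendental.KZ.Equivalent c' s) → c.value = c'.value → Literature.NumberTheory.Transcendental.KZ.Equivalent c c') :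
    ∀ (d : ℕ) (r r' : Literature.NumberTheory.Transcendental.KZ.IntegralRep d), (∀ k < d, ∀ s : Literature.NumberTheory.Transcendental.KZ.IntegralRep k, ¬ Literature.NumberTheory.Transcendental.KZ.Equivalent r s) → (∀ k < d, ∀ s : Literature.NumberTheory.Transcendental.KZ.IntegralRep k, ¬ Literature.NumberTheory.Transcendental.KZ.Equivalent r' s) → r.value = r'.value → Literature.NumberTheory.Transcendental.KZ.Equivalent r r' := by
  intro d
  match d with
  | 0 =>
    -- the rung `d = 0`: LowDimension's PROVED item `LowdimDimZero` (stmt-KontsevichZagierPeriods-0119)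
    intro r r' _ _ hv
    exact Summit.KontsevichZagierPeriods.LowDimension.LowdimDimZero.lowdimDimZero_proof r r' hv
  | 1 =>
    -- the rung `d = 1`: "incompressible" in dimension `1` means "not equivalent to a constant"
    intro r r' hr hr' hv
    exact h1 r r' (fun s hs => hr 0 Nat.zero_lt_one s hs) (fun s hs => hr' 0 Nat.zero_lt_one s hs) hv
  | n + 2 =>
    intro r r' hr hr' hv
    -- open-cube normal forms in the SAME dimension
    obtain ⟨c, hcd, hrc⟩ := h2 (n + 2) r
    obtain ⟨c', hc'd, hrc'⟩ := h2 (n + 2) r'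
    -- incompressibility travels along the equivalences
    have hcinc : ∀ k < n + 2, ∀ s : KZ.IntegralRep k, ¬ KZ.Equivalent c s :=
      fun k hk s hs => hr k hk s (hrc.trans hs)
    have hc'inc : ∀ k < n + 2, ∀ s : KZ.IntegralRep k, ¬ KZ.Equivalent c' s :=
      fun k hk s hs => hr' k hk s (hrc'.trans hs)
    -- so does the value (soundness of the moves)
    have hval : c.value = c'.value := by
      rw [← KZ.Equivalent.value_eq_holds hrc, ← KZ.Equivalent.value_eq_holds hrc', hv]
    -- the cube rung, then chain `r ∼ c ∼ c' ∼ r'`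
    exact (hrc.trans (h3 (n + 2) (Nat.le_add_left 2 n) c c' hcd hc'd hcinc hc'inc hval)).trans hrc'.symm

/-- **The skeleton theorem** (concludes the crux BY NAME; sorries enter only through the three named
stubs): `SameDegreeConjecture` from RUNG ONE, the OPEN-CUBE NORMAL FORM and the CUBE RUNGS `d ≥ 2`.
[cite: KontsevichZagierPeriods2001, §1.2 Conjecture 1] -/
theorem SameDegreeConjecture_of : SameDegreeConjecture :=
  sameDegreeConjecture_of_stubs stub_sameDegreeOne stub_openCubeNormalForm stub_sameDegreeCubeTwoUp

end Summit.KontsevichZagierPeriods.KontsevichZagierPeriods.Cruxes.SameDegreeConjecture.Birth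

end
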